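import Mathlib.Analysis.Convex.SpecificFunctions.Basic
import Mathlib.Analysis.SpecialFunctions.Trigonometric.Bounds
import Summits.RiemannHypothesis.RiemannHypothesis.Theorems.IntegerScrewTopBlockPosDefs

/-!
# P-POS soundness A: enclosure-list lemmas, the per-edge inequality, vertex regrouping, `edge_bound`

Soundness of the P-POS kernel checker `IntegerScrewTopBlockPosDefs` for the crux `TopBlockWavePos31`
(= `Manifest.TopBlockWavePos (21/50) 8 31`) of route `ScrewNyquistFloor` (planner sos-theory gen17).
PROOF-ONLY module (all definitions, incl. the real twins `FR`, `mu`, `GoodBox`, …, live in `IntegerScrewTopBlockPosDefs`).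
Part A: membership lemmas for the real twins of the list combinators (`Mems`, `MemsT`, `vertexSumR`), the
algebraic per-edge inequality `k(1−cos θ) + k sin θ·Δ − |k|(Δ²/2 + |Δ|³/6) ≤ k(1 − cos(θ+Δ))`, the regrouping
identity `Σ_e k_e s_e (η_b − η_a) = Σ_j η_j V_j`, and the combined per-edge cell bound `edge_bound`.
Nothing here bears on the truth of RH; the block `D16` is prime-free.
-/

set_option linter.dupNamespace false
set_option autoImplicit false

namespace Summit.RiemannHypothesis.RiemannHypothesis.Theorems.IntegerScrew.TopBlockPos

open Literature.Analysis.ValidatedNumerics Literature.Analysis.ValidatedNumerics.Numerics FI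

/-! ## Soundness, part A: generic enclosure-list lemmas, the per-edge trigonometric inequality,
and the vertex regrouping identity. -/

/-! ### Real twins of the list combinators -/

/-- Soundness/assembly step `Mems.sum` (P-POS package; see the module docstring). -/
theorem Mems.sum {xs : List ℝ} {L : List FI} (h : Mems xs L) : mem xs.sum (sumL L) := by
  induction h with
  | nil => simpa [sumL] using Numerics.FI.mem_zero
  | cons hx _ ih => simpa [sumL] using mem_add hx ih

/-- Soundness/assembly step `Mems.getD` (P-POS package; see the module docstring). -/
theorem Mems.getD {xs : List ℝ} {L : List FI} (h : Mems xs L) :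
    ∀ j : ℕ, mem (xs.getD j 0) (L.getD j (ofInt 0)) := by
  induction h with
  | nil => intro j; simpa using Numerics.FI.mem_zero
  | cons hx _ ih => intro j; cases j with
    | zero => simpa using hx
    | succ j => simpa using ih j

/-- Soundness/assembly step `mems_map` (P-POS package; see the module docstring). -/
theorem mems_map {α : Type*} (l : List α) {f : α → ℝ} {g : α → FI} (h : ∀ a ∈ l, mem (f a) (g a)) :
    Mems (l.map f) (l.map g) := by
  induction l with
  | nil => exact List.Forall₂.nil
  | cons a l ih =>
    exact List.Forall₂.cons (h a (by simp)) (ih fun b hb => h b (by simp [hb]))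

/-- Soundness/assembly step `Mems.getI` (P-POS package; see the module docstring). -/
theorem Mems.getI {xs : List ℝ} {L : List FI} (h : Mems xs L) (j : ℕ) : mem (getR xs j) (getI L j) :=
  h.getD j

/-- Soundness/assembly step `mems_dotL` (P-POS package; see the module docstring). -/
theorem mems_dotL {xs ys : List ℝ} {L M : List FI} (h1 : Mems xs L) (h2 : Mems ys M) :
    mem (dotR xs ys) (dotL L M) := by
  induction h1 generalizing ys M with
  | nil => cases h2 <;> simpa [dotR, dotL] using Numerics.FI.mem_zero
  | cons hx _ ih =>
    cases h2 with
    | nil => simpa [dotR, dotL] using Numerics.FI.mem_zero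
    | cons hy h2' => simpa [dotR, dotL] using mem_add (mem_mul hx hy) (ih h2')

/-- Soundness/assembly step `dotR_map` (P-POS package; see the module docstring). -/
theorem dotR_map {α : Type*} (l : List α) (f g : α → ℝ) :
    dotR (l.map f) (l.map g) = (l.map fun a => f a * g a).sum := by
  induction l with
  | nil => simp [dotR]
  | cons a l ih => simp [dotR, ih]

/-- Soundness/assembly step `memsT_map` (P-POS package; see the module docstring). -/
theorem memsT_map {α : Type*} (l : List α) {f : α → ℤ × ℝ × ℝ} {g : α → ℤ × FI × FI}
    (h : ∀ a ∈ l, (f a).1 = (g a).1 ∧ mem (f a).2.1 (g a).2.1 ∧ mem (f a).2.2 (g a).2.2) :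
    MemsT (l.map f) (l.map g) := by
  induction l with
  | nil => exact List.Forall₂.nil
  | cons a l ih =>
    exact List.Forall₂.cons (h a (by simp)) (ih fun b hb => h b (by simp [hb]))

/-- Soundness/assembly step `MemsT.map_fst` (P-POS package; see the module docstring). -/
theorem MemsT.map_fst {R : List (ℤ × ℝ × ℝ)} {T : List (ℤ × FI × FI)} (h : MemsT R T) :
    Mems (R.map fun r => r.2.1 * r.1) (T.map fun d => d.2.1.mulInt d.1) := by
  induction h with
  | nil => exact List.Forall₂.nil
  | cons hx _ ih =>
    refine List.Forall₂.cons ?_ ih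
    obtain ⟨h1, h2, _⟩ := hx
    show mem _ _; dsimp only; rw [h1]; exact mem_mulInt h2 _

/-- Soundness/assembly step `MemsT.map_snd` (P-POS package; see the module docstring). -/
theorem MemsT.map_snd {R : List (ℤ × ℝ × ℝ)} {T : List (ℤ × FI × FI)} (h : MemsT R T) :
    Mems (R.map fun r => r.2.2 * r.1) (T.map fun d => d.2.2.mulInt d.1) := by
  induction h with
  | nil => exact List.Forall₂.nil
  | cons hx _ ih =>
    refine List.Forall₂.cons ?_ ih
    obtain ⟨h1, _, h3⟩ := hx
    show mem _ _; dsimp only; rw [h1]; exact mem_mulInt h3 _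

/-- Soundness/assembly step `mem_vertexSum` (P-POS package; see the module docstring). -/
theorem mem_vertexSum {R : List (ℤ × ℝ × ℝ)} {T : List (ℤ × FI × FI)} (h : MemsT R T)
    (edges : List (ℕ × ℕ × ℤ)) (j : ℕ) : mem (vertexSumR R edges j) (vertexSum T edges j) := by
  unfold vertexSumR vertexSum
  apply Mems.sum
  induction h generalizing edges with
  | nil => cases edges <;> exact List.Forall₂.nil
  | cons hx _ ih =>
    cases edges with
    | nil => exact List.Forall₂.nil
    | cons e es =>
      simp only [List.zip_cons_cons, List.map_cons]
      refine List.Forall₂.cons ?_ (ih es)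
      obtain ⟨h1, _, h3⟩ := hx
      by_cases hb : e.2.1 = j
      · simp only [hb, if_true]; rw [h1]; exact mem_mulInt h3 _
      · by_cases ha : e.1 = j
        · simp only [hb, ha, if_false, if_true]; rw [h1]; exact mem_mulInt h3 _
        · simp only [hb, ha, if_false]; exact Numerics.FI.mem_zero

/-! ### Elementary trigonometric inequalities -/

/-- Soundness/assembly step `abs_sin_sub_self_le` (P-POS package; see the module docstring). -/
theorem abs_sin_sub_self_le (x : ℝ) : |Real.sin x - x| ≤ |x| ^ 3 / 6 := by
  rcases le_total 0 x with hx | hx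
  · have h1 := Real.sin_le hx
    have h2 := Real.sin_ge_sub_cube hx
    rw [abs_of_nonpos (by linarith), abs_of_nonneg hx]; linarith
  · have hx' : 0 ≤ -x := by linarith
    have h1 := Real.sin_le hx'
    have h2 := Real.sin_ge_sub_cube hx'
    rw [Real.sin_neg] at h1 h2
    rw [abs_of_nonneg (by nlinarith [h1, h2]), abs_of_nonpos hx]
    nlinarith [h1, h2]

/-- Soundness/assembly step `one_sub_cos_le_sq_half` (P-POS package; see the module docstring). -/
theorem one_sub_cos_le_sq_half (x : ℝ) : 1 - Real.cos x ≤ x ^ 2 / 2 := by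
  have := Real.one_sub_sq_div_two_le_cos (x := x); linarith

/-- Soundness/assembly step `one_sub_cos_nonneg` (P-POS package; see the module docstring). -/
theorem one_sub_cos_nonneg (x : ℝ) : 0 ≤ 1 - Real.cos x := by
  have := Real.cos_le_one x; linarith

/-- THE PER-EDGE INEQUALITY: expanding `cos(θ_c + Δ)`,
`k(1 − cos(θ_c + Δ)) ≥ k(1 − cos θ_c) + k sin θ_c · Δ − |k|(Δ²/2 + |Δ|³/6)`. -/
theorem edge_ineq (k θ Δ : ℝ) :
    k * (1 - Real.cos θ) + k * Real.sin θ * Δ - |k| * (Δ ^ 2 / 2 + |Δ| ^ 3 / 6)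
      ≤ k * (1 - Real.cos (θ + Δ)) := by
  rw [Real.cos_add]
  have hc := Real.abs_cos_le_one θ
  have hs := Real.abs_sin_le_one θ
  have h1 := one_sub_cos_le_sq_half Δ
  have h1' := one_sub_cos_nonneg Δ
  have h2 := abs_sin_sub_self_le Δ
  -- the error term is `E = k·[cos θ (1 − cos Δ) + sin θ (sin Δ − Δ)]`
  have key : |k * (Real.cos θ * (1 - Real.cos Δ) + Real.sin θ * (Real.sin Δ - Δ))|
      ≤ |k| * (Δ ^ 2 / 2 + |Δ| ^ 3 / 6) := by
    rw [abs_mul]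
    refine mul_le_mul_of_nonneg_left ?_ (abs_nonneg k)
    calc |Real.cos θ * (1 - Real.cos Δ) + Real.sin θ * (Real.sin Δ - Δ)|
        ≤ |Real.cos θ * (1 - Real.cos Δ)| + |Real.sin θ * (Real.sin Δ - Δ)| := abs_add_le _ _
      _ = |Real.cos θ| * (1 - Real.cos Δ) + |Real.sin θ| * |Real.sin Δ - Δ| := by
          rw [abs_mul, abs_mul, abs_of_nonneg h1']
      _ ≤ 1 * (Δ ^ 2 / 2) + 1 * (|Δ| ^ 3 / 6) := by
          gcongr
      _ = Δ ^ 2 / 2 + |Δ| ^ 3 / 6 := by ring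
  have hE : k * (1 - (Real.cos θ * Real.cos Δ - Real.sin θ * Real.sin Δ))
      = k * (1 - Real.cos θ) + k * Real.sin θ * Δ
        + k * (Real.cos θ * (1 - Real.cos Δ) + Real.sin θ * (Real.sin Δ - Δ)) := by ring
  rw [hE]
  have := neg_abs_le (k * (Real.cos θ * (1 - Real.cos Δ) + Real.sin θ * (Real.sin Δ - Δ)))
  linarith [key, this]

/-! ### Vertex regrouping: `Σ_e f_e (η_{b_e} − η_{a_e}) = Σ_{j<16} η_j (Σ_{b_e=j} f_e − Σ_{a_e=j} f_e)` -/

/-- Soundness/assembly step `head_regroup` (P-POS package; see the module docstring). -/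
theorem head_regroup (a b : ℕ) (ha : a < 16) (hb : b < 16) (hab : a ≠ b) (s : ℝ) (k : ℤ) (η : ℕ → ℝ) :
    ∑ j ∈ Finset.range 16,
        η j * (if b = j then s * (k : ℝ) else if a = j then s * ((-k : ℤ) : ℝ) else 0)
      = s * k * (η b - η a) := by
  have hsplit : ∀ j, (if b = j then s * (k : ℝ) else if a = j then s * ((-k : ℤ) : ℝ) else 0)
      = (if b = j then s * k else 0) + (if a = j then -(s * k) else 0) := by
    intro j
    by_cases h1 : b = j
    · have h2 : ¬ a = j := fun h2 => hab (h2.trans h1.symm)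
      simp [h1, h2]
    · by_cases h2 : a = j
      · simp [h1, h2]
      · simp [h1, h2]
  simp_rw [hsplit, mul_add, Finset.sum_add_distrib, mul_ite, mul_zero]
  rw [Finset.sum_ite_eq, Finset.sum_ite_eq]
  simp [Finset.mem_range, ha, hb]
  ring

/-- Soundness/assembly step `regroup` (P-POS package; see the module docstring). -/
theorem regroup (edges : List (ℕ × ℕ × ℤ)) (R : List (ℤ × ℝ × ℝ)) (hlen : R.length = edges.length)
    (hE : ∀ e ∈ edges, e.1 < 16 ∧ e.2.1 < 16 ∧ e.1 ≠ e.2.1) (η : ℕ → ℝ) :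
    ((List.zip edges R).map fun p => p.2.2.2 * (p.2.1 : ℝ) * (η p.1.2.1 - η p.1.1)).sum
      = ∑ j ∈ Finset.range 16, η j * vertexSumR R edges j := by
  unfold vertexSumR
  induction edges generalizing R with
  | nil => simp
  | cons e es ih =>
    cases R with
    | nil => simp at hlen
    | cons r rs =>
      simp only [List.length_cons, Nat.succ.injEq] at hlen
      have hE' : ∀ e ∈ es, e.1 < 16 ∧ e.2.1 < 16 ∧ e.1 ≠ e.2.1 := fun e he => hE e (by simp [he])
      obtain ⟨ha, hb, hab⟩ := hE e (by simp)
      simp only [List.zip_cons_cons, List.map_cons, List.sum_cons]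
      rw [ih rs hlen hE']
      simp only [mul_add, Finset.sum_add_distrib]
      congr 1
      exact (head_regroup e.1 e.2.1 ha hb hab r.2.2 r.1 η).symm


/-! ## Soundness, part B: an accepted cell is positive

Dictionary (reals ↔ enclosures), for a column with corner tables `M0 ∋ lo`, `M1 ∋ hi` and any node
positions `lo_j ≤ m_j ≤ hi_j`: `m̄_j = (lo_j+hi_j)/2 ∈ mList`, `w_j = (hi_j−lo_j)/2 ∈ wList`,
`η_j = m_j − m̄_j`, `|η_j| ≤ w_j`; `φ_c, φ₁, h_φ ∈ pcI, p1I, hpI`, `δ = φ − φ_c`, `|δ| ≤ h_φ`;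
`θ_e(c) = φ_c (m̄_b − m̄_a)`; `D_e = dS/SC ≥ |m_b − m_a|`, `W_e = wS/SC ≥ w_a + w_b`. -/

section CellA

/-- Soundness/assembly step `edgeL_wf` (P-POS package; see the module docstring). -/
theorem edgeL_wf : ∀ e ∈ edgeL, e.1 < 16 ∧ e.2.1 < 16 ∧ e.1 ≠ e.2.1 := by decide

/-- Soundness/assembly step `edgeL_length` (P-POS package; see the module docstring). -/
theorem edgeL_length : edgeL.length = 110 := rfl

/-! ### Small generic facts -/

/-- Soundness/assembly step `getD_map_range` (P-POS package; see the module docstring). -/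
theorem getD_map_range {α : Type*} (f : ℕ → α) (d : α) {j : ℕ} (hj : j < 16) :
    ((List.range 16).map f).getD j d = f j := by
  rw [List.getD_eq_getElem?_getD, List.getElem?_map, List.getElem?_range hj]; rfl

/-- Soundness/assembly step `getI_map_range` (P-POS package; see the module docstring). -/
theorem getI_map_range (g : ℕ → FI) {j : ℕ} (hj : j < 16) :
    getI ((List.range 16).map g) j = g j := getD_map_range g _ hj

/-- Soundness/assembly step `mem_absUp` (P-POS package; see the module docstring). -/
theorem mem_absUp {x : ℝ} {I : FI} (h : mem x I) : mem |x| (absUp I) :=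
  ⟨by simp only [absUp, Int.cast_zero]; exact mul_nonneg (abs_nonneg _) SC_pos.le, abs_le_absHi h⟩

/-- Soundness/assembly step `absHi_nonneg` (P-POS package; see the module docstring). -/
theorem absHi_nonneg (I : FI) : 0 ≤ absHi I := le_max_of_le_left (abs_nonneg _)

/-- Soundness/assembly step `mem_absUp_top` (P-POS package; see the module docstring). -/
theorem mem_absUp_top (I : FI) : mem ((absHi I : ℝ) / SC) (absUp I) := by
  have h : (absHi I : ℝ) / SC * SC = absHi I := div_mul_cancel₀ _ SC_ne
  refine ⟨?_, ?_⟩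
  · simp only [absUp, Int.cast_zero, h]; exact_mod_cast absHi_nonneg I
  · simp only [absUp, h]; exact le_rfl

/-- From `x ∈ I`: `x ≤ absHi I / SC`. -/
theorem le_absHi_div {x : ℝ} {I : FI} (hx : mem x I) : x ≤ (absHi I : ℝ) / SC := by
  have h1 := abs_le_absHi hx
  have h2 := le_abs_self x
  rw [le_div_iff₀ SC_pos]; nlinarith [SC_pos]

/-- Soundness/assembly step `abs_le_absHi_div` (P-POS package; see the module docstring). -/
theorem abs_le_absHi_div {x : ℝ} {I : FI} (hx : mem x I) : |x| ≤ (absHi I : ℝ) / SC := by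
  rw [le_div_iff₀ SC_pos]; exact abs_le_absHi hx

/-- Soundness/assembly step `le_foldr_max` (P-POS package; see the module docstring). -/
theorem le_foldr_max {l : List ℤ} {x : ℤ} (h : x ∈ l) : x ≤ l.foldr max 0 := by
  induction l with
  | nil => simp at h
  | cons y l ih =>
    simp only [List.foldr_cons]
    rcases List.mem_cons.1 h with rfl | h
    · exact le_max_left _ _
    · exact (ih h).trans (le_max_right _ _)

/-- Soundness/assembly step `zip_map_self` (P-POS package; see the module docstring). -/
theorem zip_map_self {α β : Type*} (l : List α) (f : α → β) :
    l.zip (l.map f) = l.map fun a => (a, f a) := by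
  induction l with
  | nil => rfl
  | cons a l ih => simp [ih]

/-- Soundness/assembly step `sum_range_list` (P-POS package; see the module docstring). -/
theorem sum_range_list (f : ℕ → ℝ) (n : ℕ) :
    ((List.range n).map f).sum = ∑ j ∈ Finset.range n, f j := by
  induction n with
  | zero => simp
  | succ n ih => rw [List.range_succ, List.map_append, List.sum_append, ih, Finset.sum_range_succ]; simp

/-! ### The per-edge bound with crude remainders -/

/-- Soundness/assembly step `edge_bound` (P-POS package; see the module docstring). -/
theorem edge_bound (k θc Δ δ pc p1 hp dmb dm ηa ηb wa wb W D Gcap : ℝ)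
    (hΔ : Δ = δ * dm + pc * (ηb - ηa)) (hcons : dm = dmb + (ηb - ηa))
    (hδ : |δ| ≤ hp) (hpc0 : 0 ≤ pc) (hpc1 : pc ≤ p1)
    (hdm : |dm| ≤ D) (hηa : |ηa| ≤ wa) (hηb : |ηb| ≤ wb) (hW : wa + wb ≤ W)
    (hG : hp * D + p1 * W ≤ Gcap) :
    (1 - Real.cos θc) * k + δ * (Real.sin θc * k * dmb) + pc * (Real.sin θc * k * (ηb - ηa))
      ≤ k * (1 - Real.cos (θc + Δ)) + hp * (W * |k|)
        + (1 / 2 + Gcap / 6) * ((hp * D + p1 * W) ^ 2 * |k|) := by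
  have hineq := edge_ineq k θc Δ
  have hhp : 0 ≤ hp := (abs_nonneg δ).trans hδ
  have hwa : 0 ≤ wa := (abs_nonneg _).trans hηa
  have hwb : 0 ≤ wb := (abs_nonneg _).trans hηb
  have hW0 : 0 ≤ W := by linarith
  have hD0 : 0 ≤ D := (abs_nonneg _).trans hdm
  have hp10 : 0 ≤ p1 := hpc0.trans hpc1
  have hk := abs_nonneg k
  have hηab : |ηb - ηa| ≤ W := by have := abs_sub ηb ηa; linarith
  -- (1) the `δ·Δη` cross term against `h_φ |k| W`
  have hA : |δ * (Real.sin θc * k * (ηb - ηa))| ≤ hp * (W * |k|) := by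
    rw [abs_mul, abs_mul, abs_mul]
    have hs := Real.abs_sin_le_one θc
    calc |δ| * (|Real.sin θc| * |k| * |ηb - ηa|) ≤ hp * (1 * |k| * W) := by gcongr
      _ = hp * (W * |k|) := by ring
  -- (2) `|Δ| ≤ G_e ≤ G_cap`
  have hB : |Δ| ≤ hp * D + p1 * W := by
    rw [hΔ]
    calc |δ * dm + pc * (ηb - ηa)| ≤ |δ * dm| + |pc * (ηb - ηa)| := abs_add_le _ _
      _ = |δ| * |dm| + pc * |ηb - ηa| := by rw [abs_mul, abs_mul, abs_of_nonneg hpc0]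
      _ ≤ hp * D + p1 * W := by gcongr
  have hG0 : 0 ≤ hp * D + p1 * W := (abs_nonneg _).trans hB
  have h2 : Δ ^ 2 ≤ (hp * D + p1 * W) ^ 2 := by
    rw [← sq_abs]; exact pow_le_pow_left₀ (abs_nonneg _) hB 2
  have h3 : |Δ| ^ 3 ≤ (hp * D + p1 * W) ^ 2 * Gcap :=
    calc |Δ| ^ 3 ≤ (hp * D + p1 * W) ^ 3 := pow_le_pow_left₀ (abs_nonneg _) hB 3
      _ = (hp * D + p1 * W) ^ 2 * (hp * D + p1 * W) := by ring
      _ ≤ (hp * D + p1 * W) ^ 2 * Gcap := mul_le_mul_of_nonneg_left hG (sq_nonneg _)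
  have hC : |k| * (Δ ^ 2 / 2 + |Δ| ^ 3 / 6)
      ≤ (1 / 2 + Gcap / 6) * ((hp * D + p1 * W) ^ 2 * |k|) := by
    have : Δ ^ 2 / 2 + |Δ| ^ 3 / 6 ≤ (1 / 2 + Gcap / 6) * (hp * D + p1 * W) ^ 2 := by
      nlinarith [h2, h3]
    calc |k| * (Δ ^ 2 / 2 + |Δ| ^ 3 / 6) ≤ |k| * ((1 / 2 + Gcap / 6) * (hp * D + p1 * W) ^ 2) :=
          mul_le_mul_of_nonneg_left this hk
      _ = (1 / 2 + Gcap / 6) * ((hp * D + p1 * W) ^ 2 * |k|) := by ring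
  -- (3) `k sin θc Δ = δ(k sin θc Δm̄) + δ(k sin θc Δη) + φ_c (k sin θc Δη)`
  have hid : k * Real.sin θc * Δ = δ * (Real.sin θc * k * dmb)
      + δ * (Real.sin θc * k * (ηb - ηa)) + pc * (Real.sin θc * k * (ηb - ηa)) := by
    rw [hΔ, hcons]; ring
  have hA' := neg_abs_le (δ * (Real.sin θc * k * (ηb - ηa)))
  nlinarith [hineq, hA, hA', hC, hid]

end CellA

end Summit.RiemannHypothesis.RiemannHypothesis.Theorems.IntegerScrew.TopBlockPos
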